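import Summits.Ventures.YMGap.Thresholds.StarLemmaGSuperSolution
import Summits.Ventures.YMGap.Thresholds.StarGaugeInvariance
import Summits.Ventures.YMGap.Thresholds.QuarterModulusOneHalf
import Literature.Probability.LatticeModels.DobrushinComparisonBoundary
import HarnessLib

/-!
# Venture YMGap — track (c) «DS», brick B4b (iii): LEMMA G — the star window bound for `SU(2)`,
# `d = 4`, at every `0 ≤ β_W ≤ 1/2` (the unconditional rows and fronts are in `StarLemmaGRows`)

HONEST FRAMING: venture file (cell `pub-ymgap`, PLAN R95/R96/R99), strong-coupling LATTICE statement
(currency SC-a: exponential clustering of link observables of the torus Wilson measure, uniformly in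
the side `L`); nothing about the continuum, confinement at weak coupling, or the mass gap.  This file
DISCHARGES the hypothesis `DSWindow.StarWindowBound L β_W (gaugeR β_W) suFrobDist` of the star door
(`StarWindow.su2Star_abs_covariance_le`, ds-1) for `0 ≤ β_W ≤ 1/2`, `L ≥ 3`; since `R_G(β_W) < 1`
iff `β_W < (√37 − 5)/3 = 0.3609…`, the door then gives clustering at every `β_W ≤ 9/25` with NO
hypothesis left (`StarLemmaGRows.lean`: `su2Star_abs_covariance_le_of_le_9_25`, the named rows, the fronts).

**Proof of (H1)** (cell's Lemma G: ds-2 `GAUGE-STAR.md`; assembly `B4-BLUEPRINT.md`).  For a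
boundary link `y` of the star plaquette `p_{ab}` and boundary conditions `ω = η` off `y`:
gauge-average the observable at `s` (`StarGauge.integral_sub_integral_eq_gaugeAvg`), freeze the
link `a` to `1` (`StarGauge.integral_torusWeightSpec_eq_erase`), replace the averaged observable by
its `a ← 1` section (a.s. under the frozen kernel, properness), and compare the two frozen kernels on
`⋆ ∖ {a}` by Föllmer's comparison with the super-solution `dvec`
(`DobrushinMetric.abs_kernel_sub_le_of_superSolution`, ds-1; Dobrushin coefficients
`(β_W/4) · tInfluence` from `isKRContraction_torusWilson` with the quarter modulus on tilts `≤ 3`,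
`QuarterModulusOneHalf`; `dvec_superSolution`, `rowSum_frozenStar_le`).  Averaging the bounds for
`a` and for `b` frozen gives the array `Karr` (`StarLemmaGArray`); off the star boundary the kernel
does not see `ω_y` (`StarKernel.specAvg_vertexStar_eq_of_not_mem`).  (H2) is
`StarLemmaGArray.sum_Karr_eq_gaugeR`, the support condition `Karr_loc`.

References: cell files `GAUGE-STAR.md` (ds-2), `B4-BLUEPRINT.md`, `STAR-PROOF.md` P10 (ds-4),
`LEAN-KROW.md` (ds-1); H. Föllmer, LNM 1362 (1988) Ch. I; R. L. Dobrushin, S. B. Shlosman (1985).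
-/

noncomputable section

open MeasureTheory Function Finset
open Literature.Probability.LatticeModels
open Literature.Probability.LatticeModels.DobrushinMetric
open Literature.MathematicalPhysics.QuantumFieldTheory
open Literature.MathematicalPhysics.QuantumFieldTheory.Balaban1983to89.StrongCouplingTorusWindow
open Summit.Ventures.YMGap.DSWindow
open Summit.Ventures.YMGap.StarKernel
open Summit.Ventures.YMGap.StarColumn
open Summit.Ventures.YMGap.StarWindowGauge (gaugeR)

namespace Summit.Ventures.YMGap.StarLemmaG

variable {L : ℕ} [NeZero L]

/-! ### Wilson-weight facts (`SU(2)`) -/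

omit [NeZero L] in
/-- The Wilson plaquette weight is a class function. [folklore] -/
theorem wilsonPlaqWeight_conj (β : ℝ) (g h : Matrix.specialUnitaryGroup (Fin 2) ℂ) :
    wilsonPlaqWeight 2 β (g * h * g⁻¹) = wilsonPlaqWeight 2 β h := by
  have htr : ((g * h * g⁻¹ : Matrix.specialUnitaryGroup (Fin 2) ℂ) : Matrix (Fin 2) (Fin 2) ℂ).trace =
      ((h : Matrix.specialUnitaryGroup (Fin 2) ℂ) : Matrix (Fin 2) (Fin 2) ℂ).trace := by
    rw [Submonoid.coe_mul, Matrix.trace_mul_comm, ← Submonoid.coe_mul, inv_mul_cancel_left]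
  simp only [wilsonPlaqWeight, htr]

omit [NeZero L] in
/-- The Frobenius distance on `SU(2)` is invariant under two-sided translations. [folklore] -/
theorem suFrobDist_mul_mul (a b x y : Matrix.specialUnitaryGroup (Fin 2) ℂ) :
    suFrobDist (a * x * b) (a * y * b) = suFrobDist x y := by
  unfold suFrobDist
  have h : ((a * x * b : Matrix.specialUnitaryGroup (Fin 2) ℂ) : Matrix (Fin 2) (Fin 2) ℂ) -
        ((a * y * b : Matrix.specialUnitaryGroup (Fin 2) ℂ) : Matrix (Fin 2) (Fin 2) ℂ)
      = (a : Matrix (Fin 2) (Fin 2) ℂ) *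
        ((((x : Matrix.specialUnitaryGroup (Fin 2) ℂ) : Matrix (Fin 2) (Fin 2) ℂ) -
          ((y : Matrix.specialUnitaryGroup (Fin 2) ℂ) : Matrix (Fin 2) (Fin 2) ℂ)) *
          (b : Matrix (Fin 2) (Fin 2) ℂ)) := by
    simp only [Submonoid.coe_mul]
    rw [Matrix.sub_mul, Matrix.mul_sub, Matrix.mul_assoc, Matrix.mul_assoc]
  rw [h, frobNorm_unitary_mul (su_mem_unitaryGroup a), frobNorm_mul_unitary _ (su_mem_unitaryGroup b)]

/-! ### The one-sided comparison (gauge fixed at `a`) -/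

/-- **One-sided bound.**  Star plaquette `q` of `s` with star links `a ≠ b`, boundary link `y ∈ q`
off the star, `ω = η` off `y`, `f` a bounded measurable observable of the star links with per-link
Lipschitz vector `δ` for `suFrobDist`, `0 ≤ β_W ≤ 1/2`. Then
`|∫ f dγ_⋆(ω) − ∫ f dγ_⋆(η)| ≤ suFrobDist(ω_y, η_y) · Σ_{x ∈ ⋆} (c · kside c s a b x) δ_x`, `c = β_W/4`:
gauge-average `f` at `s` (`StarGauge.integral_sub_integral_eq_gaugeAvg`), freeze `a`
(`StarGauge.integral_torusWeightSpec_eq_erase`), and compare the two frozen kernels on `⋆ ∖ {a}` by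
Föllmer's comparison with the super-solution `dvec` (`DobrushinMetric.abs_kernel_sub_le_of_superSolution`,
`isKRContraction_torusWilson` with the quarter modulus on tilts `≤ 3`, `QuarterModulusOneHalf`). [folklore] -/
theorem oneSided (hL : 3 ≤ L) {βW : ℝ} (h0 : 0 ≤ βW) (h12 : βW ≤ 1 / 2) {s : Site 4 L}
    {q : Plaquette 4 L} (hq : q ∈ starPlaqs s) {y : Edge 4 L} (hyq : y ∈ plaqEdgesT q)
    (hy : y ∉ vertexStar s) {a b : Edge 4 L} (ha : a ∈ vertexStar s) (haq : a ∈ plaqEdgesT q)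
    (hb : b ∈ vertexStar s) (hbq : b ∈ plaqEdgesT q) (hab : a ≠ b)
    {ω η : GaugeConfig 4 L (Matrix.specialUnitaryGroup (Fin 2) ℂ)} (hωη : ∀ e, e ≠ y → ω e = η e)
    {f : GaugeConfig 4 L (Matrix.specialUnitaryGroup (Fin 2) ℂ) → ℝ} (hfm : Measurable f) {B : ℝ} (hB : ∀ U, |f U| ≤ B)
    (hfdep : DependsOn f (↑(vertexStar s) : Set (Edge 4 L))) {δ : Edge 4 L → ℝ} (hδ0 : ∀ x, 0 ≤ δ x)
    (hlip : ∀ (x : Edge 4 L) (σ τ : GaugeConfig 4 L (Matrix.specialUnitaryGroup (Fin 2) ℂ)),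
      (∀ e, e ≠ x → σ e = τ e) →
      |f σ - f τ| ≤ δ x * suFrobDist (σ x) (τ x)) :
    |∫ U, f U ∂(torusWeightSpec (wilsonPlaqWeight 2 (βW / 2)) (vertexStar s) ω) -
        ∫ U, f U ∂(torusWeightSpec (wilsonPlaqWeight 2 (βW / 2)) (vertexStar s) η)| ≤
      suFrobDist (ω y) (η y) * ∑ x ∈ vertexStar s, ((βW / 4) * kside (βW / 4) s a b x) * δ x := by
  haveI : SecondCountableTopology (Matrix (Fin 2) (Fin 2) ℂ) :=
    inferInstanceAs (SecondCountableTopology (Fin 2 → Fin 2 → ℂ))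
  haveI : SecondCountableTopology (Matrix.specialUnitaryGroup (Fin 2) ℂ) :=
    Topology.IsEmbedding.subtypeVal.secondCountableTopology
  set v : Matrix.specialUnitaryGroup (Fin 2) ℂ → ℝ := wilsonPlaqWeight 2 (βW / 2) with hvdef
  have hvc : Continuous v := continuous_wilsonPlaqWeight (N := 2) (βW / 2)
  have hv0 : ∀ g, 0 < v g := wilsonPlaqWeight_pos (N := 2) (βW / 2)
  have hvconj : ∀ g h : Matrix.specialUnitaryGroup (Fin 2) ℂ, v (g * h * g⁻¹) = v h :=
    wilsonPlaqWeight_conj (βW / 2)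
  have hL1 : 1 < L := by omega
  have hΛ : ∀ e : Edge 4 L, (e.1 = s ∨ e.1.shift e.2 = s) → e ∈ vertexStar s :=
    fun e he => mem_vertexStar_iff'.2 he
  have ha' : a.1 = s ∨ a.1.shift a.2 = s := mem_vertexStar_iff'.1 ha
  have hya : y ≠ a := fun h => hy (h ▸ ha)
  -- Step 1: gauge average at `s`
  set fb := StarGauge.gaugeAvg s f with hfb
  have hfbm : Measurable fb := StarGauge.measurable_gaugeAvg s hfm
  have hfbB : ∀ U, |fb U| ≤ B := StarGauge.abs_gaugeAvg_le s hB
  have hfbdep : DependsOn fb (↑(vertexStar s) : Set (Edge 4 L)) := StarGauge.dependsOn_gaugeAvg s hfdep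
  have hfbinv : ∀ (g : Matrix.specialUnitaryGroup (Fin 2) ℂ) (U : GaugeConfig 4 L (Matrix.specialUnitaryGroup (Fin 2) ℂ)),
      fb (gaugeTransform (StarGauge.gaugeAt s g) U) = fb U :=
    StarGauge.gaugeAvg_gaugeTransform_gaugeAt s f
  have hfblip : ∀ (x : Edge 4 L) (σ τ : GaugeConfig 4 L (Matrix.specialUnitaryGroup (Fin 2) ℂ)),
      (∀ e, e ≠ x → σ e = τ e) →
      |fb σ - fb τ| ≤ δ x * suFrobDist (σ x) (τ x) :=
    StarGauge.lip_gaugeAvg s suFrobDist_mul_mul hfm hB hlip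
  rw [StarGauge.integral_sub_integral_eq_gaugeAvg hvc hv0 hvconj hΛ ω η hfm hB]
  -- Step 2: freeze the link `a`
  rw [StarGauge.integral_torusWeightSpec_eq_erase hvc hv0 hvconj hL1 hΛ ha' ω hfbm hfbB hfbinv,
    StarGauge.integral_torusWeightSpec_eq_erase hvc hv0 hvconj hL1 hΛ ha' η hfbm hfbB hfbinv]
  -- Step 3: under the frozen kernels, `fb = F := fb ∘ (update · a 1)` almost surely
  set Λ' := (vertexStar s).erase a with hΛ'
  set F : GaugeConfig 4 L (Matrix.specialUnitaryGroup (Fin 2) ℂ) → ℝ := fun U => fb (update U a 1) with hF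
  have hγ := isSpecification_torusWeightSpec (d := 4) (L := L) hvc hv0
  have step3 : ∀ ζ : GaugeConfig 4 L (Matrix.specialUnitaryGroup (Fin 2) ℂ),
      ∫ U, fb U ∂(torusWeightSpec v Λ' (update ζ a 1)) = ∫ U, F U ∂(torusWeightSpec v Λ' (update ζ a 1)) := by
    intro ζ
    refine integral_congr_ae ?_
    filter_upwards [hγ.proper Λ' (update ζ a 1)] with U hU
    have hUa : U a = 1 := by rw [hU a (notMem_erase a _), update_self]
    show fb U = fb (update U a 1)
    rw [← hUa, update_eq_self]
  rw [step3 ω, step3 η]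
  -- Step 4: Föllmer's comparison on `Λ'` with the super-solution `dvec`
  have hK : IsKRContraction (torusWeightSpec (d := 4) (L := L) (wilsonPlaqWeight 2 (βW / 2))) suFrobDist
      linkNbrT fun e z => (4 * (1 / 4)) * (|βW / 2| / (2 : ℕ)) * (tInfluence e z : ℝ) :=
    isKRContraction_torusWilson (d := 4) (N := 2) (L := L) (by norm_num) (by norm_num) hL1
      (β := βW / 2) (R := 3 * βW / 2) (K := 4 * (1 / 4)) (by norm_num)
      (by rw [abs_of_nonneg (by linarith)]; push_cast; linarith)
      (Summit.Ventures.YMGap.QuarterModulusOneHalf.oneLinkKRModulusSU2_of_le_oneHalf h12)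
  have hcoef : (4 * (1 / 4) : ℝ) * (|βW / 2| / (2 : ℕ)) = βW / 4 := by
    rw [abs_of_nonneg (by linarith)]; push_cast; ring
  simp only [hcoef] at hK
  have hc0 : 0 ≤ βW / 4 := by linarith
  have hc1 : βW / 4 ≤ 7 / 40 := by linarith
  have hyΛ' : y ∉ Λ' := fun h => hy (mem_of_mem_erase h)
  have hω'η' : ∀ z, z ≠ y → update ω a 1 z = update η a 1 z := by
    intro z hz
    by_cases hza : z = a
    · subst hza; simp
    · rw [update_of_ne hza, update_of_ne hza, hωη z hz]
  -- the test function `F`: measurable, bounded, depends on `Λ'`, Lipschitz vector `δ' = δ` off `a`, `0` at `a`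
  have hFm : Measurable F := hfbm.comp (measurable_update' (a := a) |>.comp (measurable_id.prodMk measurable_const))
  have hFB : ∀ U, |F U| ≤ B := fun U => hfbB _
  have hFdep : DependsOn F (↑Λ' : Set (Edge 4 L)) := by
    intro U U' hUU'
    show fb (update U a 1) = fb (update U' a 1)
    refine hfbdep fun e he => ?_
    by_cases hea : e = a
    · subst hea; simp
    · rw [update_of_ne hea, update_of_ne hea]
      exact hUU' e (Finset.mem_coe.2 (mem_erase.2 ⟨hea, Finset.mem_coe.1 he⟩))
  set δ' : Edge 4 L → ℝ := fun z => if z = a then 0 else δ z with hδ'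
  have hFlip : IsLipBound suFrobDist F δ' := by
    refine ⟨fun z => by simp only [hδ']; split_ifs; exacts [le_rfl, hδ0 z], fun z σ τ hστ => ?_⟩
    show |fb (update σ a 1) - fb (update τ a 1)| ≤ δ' z * suFrobDist (σ z) (τ z)
    by_cases hza : z = a
    · subst hza
      have hst : update σ z 1 = update τ z 1 := by
        funext e
        by_cases hez : e = z
        · subst hez; simp
        · rw [update_of_ne hez, update_of_ne hez, hστ e hez]
      rw [hst, sub_self, abs_zero]
      simp [hδ']
    · have h := hfblip z (update σ a 1) (update τ a 1) (fun e hez => by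
        by_cases hea : e = a
        · subst hea; simp
        · rw [update_of_ne hea, update_of_ne hea, hστ e hez])
      rw [update_of_ne hza, update_of_ne hza] at h
      simpa only [hδ', if_neg hza] using h
  have key := abs_kernel_sub_le_of_superSolution hγ hK (fun p q => suFrobDist_nonneg p q)
    (fun p q => suFrobDist_le p q) (R := 2 * Real.sqrt 2) (by positivity) Λ' hyΛ' hω'η'
    (d := dvec (βW / 4) s y a b) (dvec_nonneg hc0 hc1 s y a b) (by simp [dvec])
    (fun x hx => by
      have h := dvec_superSolution hL hc0 hc1 hq hyq hy ha haq hb hbq hab hx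
      refine le_trans (le_of_eq (sum_congr rfl fun z _ => by ring)) h)
    (c := 6 * (βW / 4)) (by linarith) (by linarith)
    (fun x hx => by
      have h := rowSum_frozenStar_le hL hc0 ha hx
      refine le_trans (le_of_eq (sum_congr rfl fun z _ => ?_)) h
      split_ifs <;> ring)
    hFm hFdep hFB hFlip
  -- rewrite the bound: `ω' y = ω y`, the sum over `Λ'` of `dvec · δ'` is the sum over `⋆` of `c · kside · δ`
  rw [update_of_ne hya, update_of_ne hya] at key
  refine key.trans (le_of_eq ?_)
  congr 1
  have hterm : ∀ z ∈ vertexStar s, dvec (βW / 4) s y a b z * δ' z = (βW / 4) * kside (βW / 4) s a b z * δ z := by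
    intro z hz
    have hzy : z ≠ y := fun h => hy (h ▸ hz)
    by_cases hza : z = a
    · subst hza; simp [dvec, kside, hδ', hzy]
    · simp only [dvec, if_neg hzy, if_pos hz, hδ', if_neg hza]
  rw [← sum_congr rfl hterm, hΛ']
  have haterm : dvec (βW / 4) s y a b a * δ' a = 0 := by simp [hδ']
  rw [sum_erase (vertexStar s) haterm]

/-! ### The theorem -/

/-- **Lemma G (ds-2, `GAUGE-STAR.md`; assembly `B4-BLUEPRINT.md`): the star window bound of the cell's
kernel row holds for `SU(2)`, `d = 4`, at every `0 ≤ β_W ≤ 1/2` with received sum `R_G(β_W)` and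
link weight `suFrobDist`** — the array is `Karr (β_W/4)`: (H1) by the two one-sided comparisons
(`oneSided`, averaged), (H2) by `sum_Karr_eq_gaugeR`, support by `Karr_loc`. With
`DSWindow.su2Star_abs_covariance_le` (which needs `R_G(β_W) < 1`, i.e. `β_W < 0.3609…`,
`StarWindowGauge.gaugeR_lt_one_of_le`) / `StarRows.su2Star_abs_covariance_le_oneThird/_7_20` this is
SC-a (exponential clustering of link observables, uniformly in the volume) at every `β_W ≤ 9/25`
(`R_G(1/3) = 13/15`, `R_G(7/20) = 1827/1933`, `R_G(9/25) = 2943/2957`). Strong-coupling lattice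
statement only; nothing about the continuum or the mass gap. [folklore] -/
theorem starWindowBound_lemmaG (hL : 3 ≤ L) {βW : ℝ} (h0 : 0 ≤ βW) (h12 : βW ≤ 1 / 2) :
    StarWindowBound L βW (gaugeR βW) suFrobDist := by
  have hL1 : 1 < L := by omega
  have hc0 : 0 ≤ βW / 4 := by linarith
  have hc1 : βW / 4 ≤ 7 / 40 := by linarith
  refine ⟨fun s y x => Karr (βW / 4) s y x, fun s y x => Karr_nonneg hc0 hc1 s y x,
    fun s y x h => Karr_loc s y x h, ?_, fun s x hx => ?_⟩
  · -- (H1)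
    intro e y hy ω η hωη f δ hfm hfB hfdep hδ0 hlip
    obtain ⟨B, hB⟩ := hfB
    set s := e.1
    change y ∉ vertexStar s at hy
    change DependsOn f (↑(vertexStar s) : Set (Edge 4 L)) at hfdep
    show |∫ U, f U ∂(torusWeightSpec (wilsonPlaqWeight 2 (βW / 2)) (vertexStar s) ω) -
        ∫ U, f U ∂(torusWeightSpec (wilsonPlaqWeight 2 (βW / 2)) (vertexStar s) η)| ≤
      (∑ x ∈ vertexStar s, Karr (βW / 4) s y x * δ x) * suFrobDist (ω y) (η y)
    by_cases hyb : y ∈ starBoundary s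
    · obtain ⟨⟨q, hq, hyq⟩, -⟩ := mem_starBoundary.1 hyb
      obtain ⟨a, b, hab, hf2⟩ := filter_mem_vertexStar_plaqEdgesT hL1 hq
      have ha2 : a ∈ (plaqEdgesT q).filter (fun e => e ∈ vertexStar s) := by rw [hf2]; simp
      have hb2 : b ∈ (plaqEdgesT q).filter (fun e => e ∈ vertexStar s) := by rw [hf2]; simp
      obtain ⟨haq, ha⟩ := mem_filter.1 ha2
      obtain ⟨hbq, hb⟩ := mem_filter.1 hb2
      have hA := oneSided hL h0 h12 hq hyq hy ha haq hb hbq hab hωη hfm hB hfdep hδ0 hlip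
      have hB' := oneSided hL h0 h12 hq hyq hy hb hbq ha haq hab.symm hωη hfm hB hfdep hδ0 hlip
      -- average the two one-sided bounds and compare with the array
      have hr0 : 0 ≤ suFrobDist (ω y) (η y) := suFrobDist_nonneg _ _
      have hpair : ∀ x ∈ vertexStar s,
          ((βW / 4) * kside (βW / 4) s a b x + (βW / 4) * kside (βW / 4) s b a x) / 2 ≤
            Karr (βW / 4) s y x := by
        intro x hx
        have hKx : Karr (βW / 4) s y x = (βW / 4 / 2) *
            ∑ q' ∈ (starPlaqs s).filter (fun q' => y ∈ plaqEdgesT q'),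
              ∑ ab ∈ starPairsOf s q', kside (βW / 4) s ab.1 ab.2 x := by
          simp only [Karr, if_pos (And.intro hx hy)]
        rw [hKx]
        have hqmem : q ∈ (starPlaqs s).filter (fun q' => y ∈ plaqEdgesT q') := mem_filter.2 ⟨hq, hyq⟩
        have hsub : ({(a, b), (b, a)} : Finset (Edge 4 L × Edge 4 L)) ⊆ starPairsOf s q := by
          intro p hp
          simp only [mem_insert, mem_singleton] at hp
          rcases hp with rfl | rfl
          · exact mem_starPairsOf.2 ⟨⟨haq, ha⟩, ⟨hbq, hb⟩, hab⟩
          · exact mem_starPairsOf.2 ⟨⟨hbq, hb⟩, ⟨haq, ha⟩, hab.symm⟩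
        have hinner : kside (βW / 4) s a b x + kside (βW / 4) s b a x ≤
            ∑ ab ∈ starPairsOf s q, kside (βW / 4) s ab.1 ab.2 x := by
          have hne : (a, b) ≠ (b, a) := fun h => hab (Prod.mk.inj h).1
          calc kside (βW / 4) s a b x + kside (βW / 4) s b a x
              = ∑ ab ∈ ({(a, b), (b, a)} : Finset (Edge 4 L × Edge 4 L)), kside (βW / 4) s ab.1 ab.2 x := by
                rw [sum_pair hne]
            _ ≤ _ := sum_le_sum_of_subset_of_nonneg hsub fun ab _ _ => kside_nonneg hc0 hc1 s _ _ _
        have houter : ∑ ab ∈ starPairsOf s q, kside (βW / 4) s ab.1 ab.2 x ≤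
            ∑ q' ∈ (starPlaqs s).filter (fun q' => y ∈ plaqEdgesT q'),
              ∑ ab ∈ starPairsOf s q', kside (βW / 4) s ab.1 ab.2 x := by
          have h := single_le_sum (f := fun q' => ∑ ab ∈ starPairsOf s q', kside (βW / 4) s ab.1 ab.2 x)
            (fun q' _ => sum_nonneg fun ab _ => kside_nonneg hc0 hc1 s _ _ _) hqmem
          exact h
        nlinarith
      have hsum : (∑ x ∈ vertexStar s, ((βW / 4) * kside (βW / 4) s a b x) * δ x +
          ∑ x ∈ vertexStar s, ((βW / 4) * kside (βW / 4) s b a x) * δ x) / 2 ≤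
            ∑ x ∈ vertexStar s, Karr (βW / 4) s y x * δ x := by
        rw [← sum_add_distrib, Finset.sum_div]
        refine sum_le_sum fun x hx => ?_
        have h := mul_le_mul_of_nonneg_right (hpair x hx) (hδ0 x)
        refine le_trans (le_of_eq ?_) h
        ring
      calc |∫ U, f U ∂(torusWeightSpec (wilsonPlaqWeight 2 (βW / 2)) (vertexStar s) ω) -
            ∫ U, f U ∂(torusWeightSpec (wilsonPlaqWeight 2 (βW / 2)) (vertexStar s) η)|
          = (|∫ U, f U ∂(torusWeightSpec (wilsonPlaqWeight 2 (βW / 2)) (vertexStar s) ω) -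
              ∫ U, f U ∂(torusWeightSpec (wilsonPlaqWeight 2 (βW / 2)) (vertexStar s) η)| +
            |∫ U, f U ∂(torusWeightSpec (wilsonPlaqWeight 2 (βW / 2)) (vertexStar s) ω) -
              ∫ U, f U ∂(torusWeightSpec (wilsonPlaqWeight 2 (βW / 2)) (vertexStar s) η)|) / 2 := by
            ring
        _ ≤ (suFrobDist (ω y) (η y) * ∑ x ∈ vertexStar s, ((βW / 4) * kside (βW / 4) s a b x) * δ x +
              suFrobDist (ω y) (η y) * ∑ x ∈ vertexStar s, ((βW / 4) * kside (βW / 4) s b a x) * δ x) / 2 := by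
            gcongr
        _ = suFrobDist (ω y) (η y) * ((∑ x ∈ vertexStar s, ((βW / 4) * kside (βW / 4) s a b x) * δ x +
              ∑ x ∈ vertexStar s, ((βW / 4) * kside (βW / 4) s b a x) * δ x) / 2) := by ring
        _ ≤ suFrobDist (ω y) (η y) * ∑ x ∈ vertexStar s, Karr (βW / 4) s y x * δ x :=
            mul_le_mul_of_nonneg_left hsum hr0
        _ = (∑ x ∈ vertexStar s, Karr (βW / 4) s y x * δ x) * suFrobDist (ω y) (η y) := mul_comm _ _
    · -- `y` off the star boundary: the kernel does not see `ω y`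
      haveI : SecondCountableTopology (Matrix (Fin 2) (Fin 2) ℂ) :=
        inferInstanceAs (SecondCountableTopology (Fin 2 → Fin 2 → ℂ))
      haveI : SecondCountableTopology (Matrix.specialUnitaryGroup (Fin 2) ℂ) :=
    Topology.IsEmbedding.subtypeVal.secondCountableTopology
      rw [specAvg_vertexStar_eq_of_not_mem (continuous_wilsonPlaqWeight (N := 2) (βW / 2)) s hfm hfdep
        hyb hωη, sub_self, abs_zero]
      exact mul_nonneg (sum_nonneg fun x _ => mul_nonneg (Karr_nonneg hc0 hc1 s y x) (hδ0 x))
        (suFrobDist_nonneg _ _)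
  · -- (H2)
    rw [sum_Karr_eq_gaugeR hL h0 (by linarith) hx]

end Summit.Ventures.YMGap.StarLemmaG

end
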